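import Mathlib
import Summits.HodgeConjecture.HodgeConjecture.Theses.SparseFermatTropicalDeficiency

/-!
# Line `spread` (strategist, alternative to `birth`) for the crux `TropicalCycleDeficiency`

Crux (route decl, fixed; item stmt-HodgeConjecture-18618): a PURE sparse Fermat datum `𝔇` and a
GENERIC `M_S`-unimodular height `h` such that for every finite polyhedral structure `Q` of the
extended tropical hypersurface `X̄_h ⊂ 𝕋ℙ^{2p+1}` and every family of `Q`-adapted real tropical
`p`-cycles, the `ℝ`-span of their classes in `H_{p,p}(X̄_h, Q; ℝ)` has dimension `< m(𝔇)`.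

## The lever: SPREADING (o-minimal / semilinear cell decomposition over `(ℝ, +, <, ℚ·)`).

At a `ℚ`-generic height `h` (`1, (h_b)_b` linearly independent over `ℚ`) every combinatorial type of
"structure `Q` of `X̄_h` + cycles on it" that is realised at all is realised by a structure whose
cells have their affine constants `ℚ`-AFFINE in the heights, `r = q₀ + Σ_b q_b h_b`
(a `ParamCell`), and this parametrised structure stays a structure of `X̄_{h'}` — with the same face
poset — for every `h'` in a RATIONAL open box `U ∋ h` inside the unimodular chamber (`IsFlatOver`).
Reason: the realisation space of a combinatorial type is a `ℚ`-semilinear set in (constants, heights);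
a `ℚ`-generic point of its projection is an interior point; definable Skolem functions of the ordered
`ℚ`-vector space `ℝ` are piecewise `ℚ`-affine (van den Dries, *Tame topology*, Ch. 1 §7 and Ch. 6
Prop. 1.2). Along a flat family the cellular chain complexes are isomorphic up to the signs of the
chosen orientations, so achievable span dimensions are CONSTANT on the box (`FlatInvariance`) and
may be read off at a RATIONAL height `h'' ∈ U`.

Consequence (the "language switch"): the crux at the intended instance follows from
`FlatDeficiencyRat` — at RATIONAL unimodular heights `h''` of `𝔇₁`, tropical 3-cycles subordinate to
a structure that is FLAT over a rational box are deficient (`span < m(𝔇₁) = 9`) — a statement about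
rational tropical varieties only (where Amini–Piquerez' unimodular triangulations, the IKMZ integral
structure and exact arithmetic are available), universally quantified over a COUNTABLE set of
`ℚ`-parametrised complexes; Amini–Piquerez' realising cycles at rational heights
[arXiv:2012.13142, Thm. 1.1] must then be RIGID (subordinate to no flat structure). Kontsevich's
scheme for tropical Weil classes on tori [arXiv:2002.02347, p. 3: "vertices vary rationally over the
space of parameters"] is the sibling of exactly this reduction; its certificate step is our heart.

## Stubs (the ONLY `sorry`s of the file; names distinct from `Lines/birth.lean`)
* `stub_pureGate : inst.IsPure` (M) and `stub_heightGate` (L) — the instance gate, shared in content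
  with `birth` (`Spread.inst` is a verbatim copy of `Birth.inst`, so the two are `rfl`-equal).
* `stub_flatSpreading : ∀ 𝔇, FlatSpreading 𝔇` (L/XL, TRUE for every datum — structural).
* `stub_flatInvariance : ∀ 𝔇, FlatInvariance 𝔇` (M/L, TRUE for every datum — chain isomorphism).
* `stub_flatDeficiencyRat : FlatDeficiencyRat inst` (XL — THE HEART, now over rational data).
* `TropicalCycleDeficiency_of` — the crux BY NAME, sorry-free composition (`deficiency_of_flat`)
  `span_Q C ≤ span_{P(h)} C' ≤ span_{P(h'')} C'' < m(𝔇₁)` with `h'' =` the rational midpoint of `U`.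
-/

noncomputable section

namespace Summit.HodgeConjecture.HodgeConjecture.Cruxes.TropicalCycleDeficiency.Spread

open scoped BigOperators Classical
open Literature.AlgebraicGeometry.Tropical Literature.AlgebraicGeometry.HodgeTheory
open Literature.AlgebraicGeometry.HodgeTheory.SparseFermat

/-! ### The instance `𝔇₁ = (3, 8, B₁)` (verbatim copy of `Lines/birth.lean`, hence `rfl`-equal) -/

/-- The residues mod 8 of the four seed monomials `x₁x₂x₄x₅⁴x₇, x₁x₂x₃⁴x₄x₇, x₁²x₂²x₄²x₆²,
x₀²x₁²x₂⁴` (they generate the character lattice `Λ`, `|Λ| = 256`). -/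
def seedResidues : Set (Fin (2 * 3 + 2) → ZMod 8) :=
  {![0, 1, 1, 0, 1, 4, 0, 1], ![0, 1, 1, 4, 1, 0, 0, 1], ![0, 2, 2, 0, 2, 0, 2, 0],
    ![2, 2, 4, 0, 0, 0, 0, 0]}

/-- The character lattice `Λ ⊂ (ℤ/8)⁸` generated by the seed residues. -/
def seedLattice : AddSubgroup (Fin (2 * 3 + 2) → ZMod 8) :=
  AddSubgroup.closure seedResidues

/-- `B₁`: all degree-8 monomials in `x₀, …, x₇` with at least two variables whose residue mod 8 lies
in `Λ` (10 of them: `x₆²x₇⁶, x₆⁴x₇⁴, x₆⁶x₇², x₃⁴x₅⁴, x₁x₂x₄x₅⁴x₇, x₁x₂x₃⁴x₄x₇, x₁²x₂²x₄²x₇²,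
x₁²x₂²x₄²x₆², x₀²x₁²x₂⁴, x₀⁴x₁⁴`). -/
def octicMonomials : Finset (Fin (2 * 3 + 2) →₀ ℕ) :=
  ((Finset.Nat.antidiagonalTuple (2 * 3 + 2) 8).map
      Finsupp.equivFunOnFinite.symm.toEmbedding).filter
    fun b ↦ 2 ≤ b.support.card ∧ (fun i ↦ ((b i : ℕ) : ZMod 8)) ∈ seedLattice

/-- Members of `B₁` have degree 8. -/
theorem degree_of_mem_octicMonomials {b : Fin (2 * 3 + 2) →₀ ℕ} (hb : b ∈ octicMonomials) :
    (∑ i, b i) = 8 := by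
  simp only [octicMonomials, Finset.mem_filter, Finset.mem_map] at hb
  obtain ⟨⟨a, ha, rfl⟩, -, -⟩ := hb
  rw [Finset.Nat.mem_antidiagonalTuple] at ha
  simpa using ha

/-- Members of `B₁` involve at least two variables. -/
theorem two_le_card_support_of_mem_octicMonomials {b : Fin (2 * 3 + 2) →₀ ℕ}
    (hb : b ∈ octicMonomials) : 2 ≤ b.support.card := by
  simp only [octicMonomials, Finset.mem_filter] at hb
  exact hb.2.1

/-- The intended instance `𝔇₁ = (p, d, B) = (3, 8, B₁)` (octic sixfolds in `ℙ⁷`; `m(𝔇₁) = 9`). -/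
def inst : Datum where
  p := 3
  d := 8
  B := octicMonomials
  two_le_p := by norm_num
  three_le_d := by norm_num
  degree_eq := fun _ hb ↦ degree_of_mem_octicMonomials hb
  two_le_card_support := fun _ hb ↦ two_le_card_support_of_mem_octicMonomials hb

/-! ### `ℚ(h)`-affine (parametrised) cells, rational boxes, flat families of structures -/

/-- A `ℚ`-affine function of the heights, `(q₀, (q_b)_b) ↦ q₀ + Σ_b q_b h_b`. -/
abbrev AffQ (β : Type) : Type := ℚ × (β → ℚ)

/-- Evaluation of a `ℚ`-affine function of the heights at `h`. -/
def affEval {β : Type} [Fintype β] (h : β → ℝ) (a : AffQ β) : ℝ :=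
  (a.1 : ℝ) + ∑ b, (a.2 b : ℝ) * h b

/-- A parametrised cell: integral forms, affine constants `ℚ`-affine in the heights. -/
structure ParamCell (N : ℕ) (β : Type) where
  /-- the sedentarity -/
  sed : Finset (Fin N)
  /-- parametrised equations `⟨m, u⟩ = q₀ + Σ_b q_b h_b` -/
  eqs : Finset ((Fin N → ℤ) × AffQ β)
  /-- parametrised strict inequalities `⟨m, u⟩ > q₀ + Σ_b q_b h_b` -/
  stricts : Finset ((Fin N → ℤ) × AffQ β)

namespace ParamCell

/-- The cell of `𝕋ℙ^{N-1}` obtained by evaluating the constants at the height `h`. -/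
def eval {N : ℕ} {β : Type} [Fintype β] (h : β → ℝ) (P : ParamCell N β) : TropCell N where
  sed := P.sed
  eqs := P.eqs.image fun e ↦ (e.1, affEval h e.2)
  stricts := P.stricts.image fun e ↦ (e.1, affEval h e.2)

end ParamCell

/-- The open box `Π_b (l_b, u_b)` with RATIONAL corners. -/
def box {β : Type} (l u : β → ℚ) : Set (β → ℝ) :=
  {h | ∀ b, (l b : ℝ) < h b ∧ h b < (u b : ℝ)}

/-- The rational midpoint of a box. -/
def boxMid {β : Type} (l u : β → ℚ) : β → ℝ := fun b ↦ (((l b + u b) / 2 : ℚ) : ℝ)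

theorem boxMid_mem_box {β : Type} {l u : β → ℚ} {h : β → ℝ} (hh : h ∈ box l u) :
    boxMid l u ∈ box l u := by
  intro b
  obtain ⟨h1, h2⟩ := hh b
  have hlu : (l b : ℝ) < (u b : ℝ) := h1.trans h2
  simp only [boxMid]
  push_cast
  constructor <;> linarith

theorem boxMid_rational {β : Type} (l u : β → ℚ) : ∀ b, ∃ q : ℚ, boxMid l u b = (q : ℝ) :=
  fun b ↦ ⟨(l b + u b) / 2, rfl⟩

/-- A height with rational coordinates. -/
def IsRationalHeight {β : Type} (h : β → ℝ) : Prop := ∀ b, ∃ q : ℚ, h b = (q : ℝ)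

/-- The evaluated (honest) polyhedral structure of a finite set of parametrised cells. -/
def evalStr {N : ℕ} {β : Type} [Fintype β] (P : Finset (ParamCell N β)) (h : β → ℝ) :
    Finset (TropCell N) :=
  P.image (ParamCell.eval h)

/-- `P` is FLAT over the box: at every height of the box its evaluation is a polyhedral structure of
`X̄_h`, no two parametrised cells collide, and the face poset is the same at any two heights of the
box. -/
def IsFlatOver (𝔇 : Datum) (P : Finset (ParamCell (2 * 𝔇.p + 2) ↥𝔇.B)) (l u : ↥𝔇.B → ℚ) :
    Prop :=
  ∀ h ∈ box l u,
    IsStructureOf (evalStr P h) (𝔇.tropicalVariety h) ∧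
    Set.InjOn (ParamCell.eval h) (P : Set (ParamCell (2 * 𝔇.p + 2) ↥𝔇.B)) ∧
    ∀ h' ∈ box l u, ∀ σ ∈ P, ∀ τ ∈ P,
      (TropCell.IsFace (τ.eval h) (σ.eval h) ↔ TropCell.IsFace (τ.eval h') (σ.eval h'))

/-! ### Stub statements (named `Prop`s) -/

/-- SPREADING (structural, every datum): at a generic unimodular height, the span of the classes of
any family of cycles on any structure `Q` of `X̄_h` is dominated by the span of a family of cycles on
the evaluation AT `h` of a structure FLAT over a rational box `U ∋ h` contained in the unimodular
locus. [van den Dries 1998, Ch. 1 §7 (semilinear cell decomposition) and Ch. 6 Prop. 1.2 (definable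
choice)] [arXiv:2002.02347, p. 3] -/
def FlatSpreading (𝔇 : Datum) : Prop :=
  ∀ h : ↥𝔇.B → ℝ, 𝔇.IsGenericHeight h → 𝔇.IsUnimodularHeight h →
    ∀ Q : Finset (TropCell (2 * 𝔇.p + 2)), IsStructureOf Q (𝔇.tropicalVariety h) →
      ∀ (κ : Type) (C : κ → TropCycle Q 𝔇.p),
        ∃ l u : ↥𝔇.B → ℚ, h ∈ box l u ∧ (∀ h' ∈ box l u, 𝔇.IsUnimodularHeight h') ∧
          ∃ P : Finset (ParamCell (2 * 𝔇.p + 2) ↥𝔇.B), IsFlatOver 𝔇 P l u ∧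
            ∃ (κ' : Type) (C' : κ' → TropCycle (evalStr P h) 𝔇.p),
              Module.finrank ℝ ↥(Submodule.span ℝ (Set.range fun k ↦ (C k).cls)) ≤
                Module.finrank ℝ ↥(Submodule.span ℝ (Set.range fun k ↦ (C' k).cls))

/-- FLAT INVARIANCE (structural, every datum): along a flat family the achievable span dimensions of
cycle classes do not depend on the height in the box (the cellular chain complexes at two heights of
the box are isomorphic up to the signs of the chosen orientations). [arXiv:1108.2837 (Mikhalkin–
Zharkov), §2.2 and Prop. 2.2] -/
def FlatInvariance (𝔇 : Datum) : Prop :=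
  ∀ (P : Finset (ParamCell (2 * 𝔇.p + 2) ↥𝔇.B)) (l u : ↥𝔇.B → ℚ), IsFlatOver 𝔇 P l u →
    ∀ h ∈ box l u, ∀ h' ∈ box l u, ∀ (κ : Type) (C : κ → TropCycle (evalStr P h) 𝔇.p),
      ∃ (κ' : Type) (C' : κ' → TropCycle (evalStr P h') 𝔇.p),
        Module.finrank ℝ ↥(Submodule.span ℝ (Set.range fun k ↦ (C k).cls)) ≤
          Module.finrank ℝ ↥(Submodule.span ℝ (Set.range fun k ↦ (C' k).cls))

/-- FLAT DEFICIENCY AT RATIONAL HEIGHTS (the heart, instance-specific): for every rational box `U`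
inside the unimodular locus, every structure `P` flat over `U` and every RATIONAL height `h'' ∈ U`,
the classes of tropical `p`-cycles subordinate to `P(h'')` span a subspace of `H_{p,p}(X̄_{h''})` of
dimension `< m(𝔇)`: at rational heights, MOVABLE cycles are deficient (Amini–Piquerez' realising
cycles are rigid). [arXiv:2012.13142, Thm. 1.1 and Conj. 1.2] [arXiv:2002.02347, pp. 2–3] -/
def FlatDeficiencyRat (𝔇 : Datum) : Prop :=
  ∀ l u : ↥𝔇.B → ℚ, (∀ h ∈ box l u, 𝔇.IsUnimodularHeight h) →
    ∀ P : Finset (ParamCell (2 * 𝔇.p + 2) ↥𝔇.B), IsFlatOver 𝔇 P l u →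
      ∀ h ∈ box l u, IsRationalHeight h →
        ∀ (κ : Type) (C : κ → TropCycle (evalStr P h) 𝔇.p),
          Module.finrank ℝ ↥(Submodule.span ℝ (Set.range fun k ↦ (C k).cls)) < 𝔇.invariantRank

/-! ### Stubs (the ONLY `sorry`s of the file) -/

/-- Stub 1 (M — instance gate, characters): `𝔇₁` is pure (8 admissible characters in `Λ`, all
Hodge). [Shioda 1979 (Math. Ann. 245), Thm. I] -/
theorem stub_pureGate : inst.IsPure := by
  sorry

/-- Stub 2 (L — instance gate, polyhedral): the 18-point configuration `S = {8eᵢ} ∪ B₁` has a regular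
`M_S`-unimodular triangulation (256 maximal simplices) whose open secondary chamber contains a
`ℚ`-generic height. [Maclagan–Sturmfels 2015, §2.3 and §4.5] -/
theorem stub_heightGate :
    ∃ h : ↥inst.B → ℝ, inst.IsGenericHeight h ∧ inst.IsUnimodularHeight h := by
  sorry

/-- Stub 3 (L/XL — structural, every datum): spreading of structures and cycles at a generic height
into a flat `ℚ(h)`-affine family over a rational box. [van den Dries 1998, Ch. 6 Prop. 1.2]
[arXiv:2002.02347, p. 3] -/
theorem stub_flatSpreading : ∀ 𝔇 : Datum, FlatSpreading 𝔇 := by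
  sorry

/-- Stub 4 (M/L — structural, every datum): span dimensions are constant along a flat family.
[arXiv:1108.2837, §2.2 and Prop. 2.2] -/
theorem stub_flatInvariance : ∀ 𝔇 : Datum, FlatInvariance 𝔇 := by
  sorry

/-- Stub 5 (XL, hardest — the heart over rational data): movable tropical 3-cycles are deficient at
the rational unimodular heights of `𝔇₁`. [arXiv:2012.13142, Conj. 1.2 (negated for movable cycles)]
[arXiv:2002.02347, pp. 2–3 (Kontsevich's certificate step, hypersurface version)] -/
theorem stub_flatDeficiencyRat : FlatDeficiencyRat inst := by
  sorry

/-! ### Composition (sorry-free) -/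

/-- The implication content, sorry-free and for EVERY datum; the conclusion is the crux statement
UNFOLDED (so that exactly one theorem of the file, `TropicalCycleDeficiency_of`, concludes the crux by name). -/
theorem deficiency_of_flat (𝔇 : Datum) (h₁ : 𝔇.IsPure)
    (h₂ : ∃ h : ↥𝔇.B → ℝ, 𝔇.IsGenericHeight h ∧ 𝔇.IsUnimodularHeight h)
    (h₃ : FlatSpreading 𝔇) (h₄ : FlatInvariance 𝔇) (h₅ : FlatDeficiencyRat 𝔇) :
    ∃ 𝔇' : Datum, 𝔇'.IsPure ∧ ∃ h : ↥𝔇'.B → ℝ, 𝔇'.IsGenericHeight h ∧ 𝔇'.IsUnimodularHeight h ∧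
      ∀ Q : Finset (TropCell (2 * 𝔇'.p + 2)), IsStructureOf Q (𝔇'.tropicalVariety h) →
        ∀ (κ : Type) (C : κ → TropCycle Q 𝔇'.p),
          Module.finrank ℝ ↥(Submodule.span ℝ (Set.range fun k ↦ (C k).cls)) < 𝔇'.invariantRank := by
  obtain ⟨h, hgen, huni⟩ := h₂
  refine ⟨𝔇, h₁, h, hgen, huni, fun Q hQ κ C ↦ ?_⟩
  obtain ⟨l, u, hmem, hU, P, hP, κ', C', hle⟩ := h₃ h hgen huni Q hQ κ C
  obtain ⟨κ'', C'', hle'⟩ := h₄ P l u hP h hmem (boxMid l u) (boxMid_mem_box hmem) κ' C'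
  exact (hle.trans hle').trans_lt
    (h₅ l u hU P hP (boxMid l u) (boxMid_mem_box hmem) (boxMid_rational l u) κ'' C'')

/-- **THE SKELETON THEOREM.** The crux
`Summit.HodgeConjecture.HodgeConjecture.Theses.SparseFermatTropicalDeficiency.TropicalCycleDeficiency`,
concluded BY NAME from the five declared stubs through the sorry-free composition at `𝔇₁`. -/
theorem TropicalCycleDeficiency_of :
    Summit.HodgeConjecture.HodgeConjecture.Theses.SparseFermatTropicalDeficiency.TropicalCycleDeficiency :=
  deficiency_of_flat inst stub_pureGate stub_heightGate (stub_flatSpreading inst)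
    (stub_flatInvariance inst) stub_flatDeficiencyRat

end Summit.HodgeConjecture.HodgeConjecture.Cruxes.TropicalCycleDeficiency.Spread

end
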